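import Literature.AlgebraicGeometry.Resolution.BlowupChartMembership
import Literature.AlgebraicGeometry.Resolution.BlowupChartRsop
import HarnessLib

/-!
# One chart of a blowing up, read for an explicit generating family of the centre's ideal

`Literature/AlgebraicGeometry/Resolution/BlowupChartOfSpan.lean` (HIRONAKA-L discharge lane, librarian
res-D-lib-2, dedupe hoist; DEF-FREE). Two pieces of scheme plumbing over the tree's blow-up chart API
(`BlowupChartMembership.lean`: `IsBlowup.exists_charts`, `top_le_preimage_of_chart`, `appLE_chart_eq`,
`IsBlowup.mem_range_chart_of_stalkIdeal_eq_span`; `BlowupChartRsop.lean`: `chartRing c j = (R[It])_{(c_j t)}`,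
`chartBase c j : R → chartRing c j`) [cite: StacksProject, Tag 0804 (affine charts of a blowing up)]:

* `IsBlowup.exists_chart_of_ideal_eq_span` — for a blowing up `π : X' → X` along `C`, an affine open `U`
  and generators `c` of `C(U)`, the chart `g_j : Spec (chartRing c j) → X'` is an open immersion over
  `Spec Γ(X,U) → X` through `chartBase c j` and contains every point of `X'` over `U` at which `c_j`
  generates the exceptional ideal;
* `stalkMap_stalkMap_germ_of_chart` — on a chart `g : Spec D → X'` with
  `g ≫ π = Spec f ≫ (Spec Γ(X,U) → X)`, the composite of germs `g^♯_w ∘ π^♯_{g w} ∘ germ_U` is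
  `(D → 𝒪_{Spec D,w}) ∘ f`.

WHY (librarian census 2026-08-27T12:4xZ): both were private lemmas of
`CossartJannsenSaito2020/ProjDirLine.lean` re-pasted privately in `ProjDirClosed`, `ProjDirProjectiveLineCharts`,
`ProjDirProjectiveLineRegular`, `ProjDirProjectiveLineResidueGeneric` (5 Literature files) and exported only
Summits-side (`…Corridor3NearFibreChart.exists_chart_of_ideal_eq_span'` / `stalkMap_stalkMap_germ_of_chart'`,
res-L1-w42-stub-3), which Literature files cannot import. Proofs verbatim from those copies (credit:
res-type-031 / res-L1-w42 line). Nothing here is a statement about resolution of singularities.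
-/

noncomputable section

open CategoryTheory AlgebraicGeometry TopologicalSpace IsLocalRing

namespace Literature.AlgebraicGeometry.Resolution

universe u

/-- **The chart of a blowing up attached to one generator of the centre's ideal.** For a blowing up `π` along `C`,
an affine open `U` and a generating family `c` of `I = C(U)` (so that the chart ring is literally
`chartRing c j = (R[It])_{(c_j t)}`): the chart `g_j : Spec (chartRing c j) → X'` is an open immersion over
`Spec R → X` through `chartBase c j`, and contains every point at which `c_j` generates the exceptional ideal
(`IsBlowup.exists_charts`, `IsBlowup.mem_range_chart_of_stalkIdeal_eq_span`).
[cite: StacksProject, Tag 0804 (affine charts of a blowing up)] -/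
theorem IsBlowup.exists_chart_of_ideal_eq_span {X' X : Scheme.{u}} {π : X' ⟶ X} {C : X.IdealSheafData}
    (hπ : IsBlowup π C) (U : X.affineOpens) {r : ℕ} (c : Fin r → Γ(X, U))
    (hc : C.ideal U = Ideal.span (Set.range c)) (j : Fin r) :
    ∃ g : Spec (.of (chartRing c j)) ⟶ X', IsOpenImmersion g ∧
      g ≫ π = Spec.map (CommRingCat.ofHom (chartBase c j)) ≫ U.2.fromSpec ∧
      ∀ (x' : X') (hx : π x' ∈ (U : X.Opens)),
        stalkIdeal (C.comap π) x' =
            Ideal.span {(π.stalkMap x').hom ((X.presheaf.germ U (π x') hx).hom (c j))} →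
          x' ∈ Set.range g := by
  have key : ∀ (I : Ideal Γ(X, U)) (_ : C.ideal U = I) (b : Γ(X, U)) (hb : b ∈ I),
      ∃ g : Spec (.of (HomogeneousLocalization.Away (reesGrading I) (reesT b hb))) ⟶ X',
        IsOpenImmersion g ∧
        g ≫ π = Spec.map (CommRingCat.ofHom (reesChartBase b hb)) ≫ U.2.fromSpec ∧
        ∀ (x' : X') (hx : π x' ∈ (U : X.Opens)),
          stalkIdeal (C.comap π) x' =
              Ideal.span {(π.stalkMap x').hom ((X.presheaf.germ U (π x') hx).hom b)} →
            x' ∈ Set.range g := by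
    rintro I rfl b hb
    obtain ⟨g, h1, h2, -⟩ := hπ.exists_charts U
    exact ⟨g b hb, h1 b hb, h2 b hb, fun x' hx hgen =>
      hπ.mem_range_chart_of_stalkIdeal_eq_span U hb (g b hb) (h2 b hb) hx hgen⟩
  exact key _ hc (c j) (Ideal.mem_span_range_self (f := c) (x := j))

/-- **Germs along a chart.** On a chart `g : Spec D → X'` with `g ≫ π = Spec f ≫ (Spec Γ(X, U) → X)`:
`g^♯_w ∘ π^♯_{g w} ∘ germ_U = (D → 𝒪_{Spec D, w}) ∘ f` (the germ form of `appLE_chart_eq`).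
[cite: StacksProject, Tag 0804 (affine charts of a blowing up)] -/
theorem stalkMap_stalkMap_germ_of_chart {X' X : Scheme.{u}} (π : X' ⟶ X) (U : X.affineOpens)
    {D : CommRingCat.{u}} (g : Spec D ⟶ X') (f : Γ(X, U) ⟶ D)
    (hg : g ≫ π = Spec.map f ≫ U.2.fromSpec) (w : Spec D) (hx : π (g w) ∈ (U : X.Opens)) (r : Γ(X, U)) :
    (g.stalkMap w).hom ((π.stalkMap (g w)).hom ((X.presheaf.germ U (π (g w)) hx).hom r)) =
      ((Spec D).presheaf.germ ⊤ w trivial).hom ((Scheme.ΓSpecIso D).inv.hom (f.hom r)) := by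
  have e := top_le_preimage_of_chart U g f hg
  have h1 : ((Spec D).presheaf.germ ⊤ w trivial).hom ((g ≫ π).appLE U ⊤ e r) =
      ((g ≫ π).stalkMap w).hom ((X.presheaf.germ U ((g ≫ π) w) (e trivial)).hom r) := by
    change ((g ≫ π).appLE U ⊤ e ≫ (Spec D).presheaf.germ ⊤ w trivial).hom r =
      (X.presheaf.germ U ((g ≫ π) w) (e trivial) ≫ (g ≫ π).stalkMap w).hom r
    rw [Scheme.Hom.germ_stalkMap, Scheme.Hom.appLE, Category.assoc, (Spec D).presheaf.germ_res]
  rw [appLE_chart_eq U g f hg e, Scheme.Hom.stalkMap_comp] at h1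
  exact h1.symm

/-! ## §2 At a point of a chart the exceptional ideal is generated by ONE of the centre's generators

(Appended 2026-08-27T13:2xZ, librarian res-D-lib-2.) In a LOCAL ring, if `(u_1, …, u_r) = (t)` with `t` a
nonzerodivisor then `(u_j) = (t)` for some `j` — at a point of a chart of a blowing up, the exceptional
ideal (generated by the images of the centre's generators) is generated by one of them. These were private
in `CossartJannsenSaito2020/ProjDirClosed`, `ProjDirProjectiveSpaceLocal`, `ProjDirProjectiveSpaceResidue`
(general `r`) and `ProjDirProjectiveLineCharts` / `…Regular` / `…ResidueGeneric` (pairs). -/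

/-- **In a local ring, a principal nonzerodivisor ideal generated by a finite family is generated by one member
of the family**: if `(u_i : i ∈ ι) = (t)` with `t` a nonzerodivisor of the local ring `B`, then `(u_j) = (t)`
for some `j`. Writing `u_i = b_i t` and `t = Σ a_i u_i = t Σ a_i b_i` gives `Σ a_i b_i = 1`, so some
`a_j b_j` is a unit. (At a point of a chart of a blowing up, the exceptional ideal — generated by the images
of the generators of the centre's ideal — is generated by one of them.)
[cite: StacksProject, Tag 0804 (affine charts of a blowing up: the exceptional ideal is invertible, generated by the image of one generator on each chart)] -/
theorem exists_span_singleton_eq_of_span_range_eq {B : Type*} [CommRing B] [IsLocalRing B] {ι : Type*}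
    [Fintype ι] (u : ι → B) {t : B} (ht : t ∈ nonZeroDivisors B)
    (h : Ideal.span (Set.range u) = Ideal.span {t}) : ∃ j, Ideal.span {u j} = Ideal.span {t} := by
  classical
  have hb : ∀ l, ∃ b : B, b * t = u l := fun l =>
    Ideal.mem_span_singleton'.mp (h ▸ Ideal.subset_span ⟨l, rfl⟩)
  choose b hb using hb
  obtain ⟨a, ha⟩ : ∃ a : ι → B, ∑ l, a l * u l = t :=
    Ideal.mem_span_range_iff_exists_fun.mp (h.symm ▸ Ideal.mem_span_singleton_self t)
  have hsum : ∑ l, a l * b l = 1 := by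
    have h1 : (∑ l, a l * b l - 1) * t = 0 := by
      rw [sub_mul, one_mul, Finset.sum_mul, sub_eq_zero]
      conv_rhs => rw [← ha]
      exact Finset.sum_congr rfl fun l _ => by rw [mul_assoc, hb l]
    exact sub_eq_zero.mp ((mem_nonZeroDivisors_iff_right.mp ht) _ h1)
  have hex : ∃ j, IsUnit (a j * b j) := by
    by_contra hall
    simp only [not_exists] at hall
    have hmem : ∑ l, a l * b l ∈ maximalIdeal B :=
      Ideal.sum_mem _ fun l _ => (mem_maximalIdeal _).mpr (mem_nonunits_iff.mpr (hall l))
    rw [hsum] at hmem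
    exact (mem_maximalIdeal _).mp hmem isUnit_one
  obtain ⟨j, hj⟩ := hex
  refine ⟨j, ?_⟩
  rw [← hb j, Ideal.span_singleton_mul_left_unit (isUnit_of_mul_isUnit_right hj)]

/-- **In a local ring, if `(u, v) = (t)` with `t` a nonzerodivisor then `(u) = (t)` or `(v) = (t)`** (the case of two
generators). [cite: StacksProject, Tag 0804 (affine charts of a blowing up: the exceptional ideal is invertible, generated by the image of one generator on each chart)] -/
theorem span_singleton_eq_or_of_span_pair_eq {B : Type*} [CommRing B] [IsLocalRing B] {u v t : B}
    (ht : t ∈ nonZeroDivisors B) (h : Ideal.span {u, v} = Ideal.span {t}) :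
    Ideal.span {u} = Ideal.span {t} ∨ Ideal.span {v} = Ideal.span {t} := by
  obtain ⟨bu, hbu⟩ : ∃ b : B, b * t = u := Ideal.mem_span_singleton'.mp (h ▸ Ideal.subset_span (by simp))
  obtain ⟨bv, hbv⟩ : ∃ b : B, b * t = v := Ideal.mem_span_singleton'.mp (h ▸ Ideal.subset_span (by simp))
  obtain ⟨au, av, hauv⟩ : ∃ au av : B, au * u + av * v = t :=
    Ideal.mem_span_pair.mp (h.symm ▸ Ideal.mem_span_singleton_self t)
  have hsum : au * bu + av * bv = 1 := by
    have h1 : (au * bu + av * bv - 1) * t = 0 := by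
      rw [sub_mul, one_mul, add_mul, mul_assoc, mul_assoc, hbu, hbv, hauv, sub_self]
    exact sub_eq_zero.mp ((mem_nonZeroDivisors_iff_right.mp ht) _ h1)
  rcases IsLocalRing.isUnit_or_isUnit_of_add_one hsum with hu | hv
  · left
    rw [← hbu, Ideal.span_singleton_mul_left_unit (isUnit_of_mul_isUnit_right hu)]
  · right
    rw [← hbv, Ideal.span_singleton_mul_left_unit (isUnit_of_mul_isUnit_right hv)]

/-- If `(u) = (t)` with `t` a nonzerodivisor and `u = b · t`, then `b` is a unit (any commutative ring).
[cite: StacksProject, Tag 0804 (affine charts of a blowing up: the exceptional ideal is invertible)] -/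
theorem isUnit_of_mul_eq_of_span_singleton_eq {B : Type*} [CommRing B] {u t b : B}
    (ht : t ∈ nonZeroDivisors B) (hb : b * t = u) (h : Ideal.span {u} = Ideal.span {t}) : IsUnit b := by
  obtain ⟨a, ha⟩ : ∃ a : B, a * u = t :=
    Ideal.mem_span_singleton'.mp (h.symm ▸ Ideal.mem_span_singleton_self t)
  have h1 : (a * b - 1) * t = 0 := by
    rw [sub_mul, one_mul, mul_assoc, hb, ha, sub_self]
  have hab : a * b = 1 := sub_eq_zero.mp ((mem_nonZeroDivisors_iff_right.mp ht) _ h1)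
  exact isUnit_of_mul_isUnit_right (hab ▸ isUnit_one)

end Literature.AlgebraicGeometry.Resolution
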